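import Mathlib.LinearAlgebra.Matrix.Charpoly.Basic
import Mathlib.Data.Matrix.ColumnRowPartitioned
import Mathlib.Analysis.SpecialFunctions.Pow.Real

/-!
# Exact trilayer (odd = non-bonding / even ⊕ inner) splitting identities

The EXACT algebra behind the "trilayer ↦ bonding / NON-BONDING / antibonding" bookkeeping used
for three-layer cuprates (HgBa₂Ca₂Cu₃O₈, Bi-2223) and for the trilayer nickelate La₄Ni₃O₁₀, the
companion of `BilayerSplittingIdentities`.  Everything is a proved theorem; there are no named
facts.  The physics (which orbitals couple the planes, the sizes of the couplings, the inner/outer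
site-energy difference) lives in the cited sources, not here.

## 1. Block form over a commutative ring

A mirror-symmetric trilayer has two EQUIVALENT outer planes with one-particle block `H`, an inner
plane with block `K` (in general `K ≠ H`: the inner plane has its own site energy and dispersion,
e.g. the inner/outer `ΔE`, `t` rows of the six-orbital model of [SakakibaraEtAl2024, Table I]),
an outer–inner coupling block `T` (the same for both outer planes, by the mirror) and, for
generality, a direct outer–outer block `S`.  With the layer order (outer₁ | outer₂, inner) it is
the block matrix `trilayer H K T S = fromBlocks H (fromCols S T) (fromRows S T) (fromBlocks H T T K)`.
The ODD outer combination decouples EXACTLY: `(x, −x, 0)` is an eigenvector whenever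
`(H − S) x = ω x` (`trilayer_mulVec_odd`), with ZERO inner-plane component and an energy that does
not involve `K` or `T` at all — the "non-bonding" band, printed for La₄Ni₃O₁₀ as the `d_{3z²−r²}`
band whose eigenstates "contain the inner-layer components less than 5%" in the ab initio bands
and exactly none in the mirror-symmetric model [SakakibaraEtAl2024, §III and Fig. 2 caption].  The
EVEN sector is the `2 × 2`-block problem `fromBlocks (H + S) T (2 • T) K` on (outer-even, inner)
(`trilayer_mulVec_even`).  The unnormalised combiner `P : (x₁ | x₂, x₃) ↦ (x₁ − x₂ | x₁ + x₂, x₃)`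
intertwines the trilayer with the block-diagonal matrix
`trilayerSplit H K T S = fromBlocks (H − S) 0 0 (fromBlocks (H + S) (2 • T) T K)` over ANY
commutative ring (`trilayerCombiner_mul_trilayer`), and when `2` is invertible the characteristic
polynomial FACTORISES:
`charpoly (trilayer H K T S) = charpoly (H − S) * charpoly (fromBlocks (H + S) (2 • T) T K)`
(`charpoly_trilayer`) — the trilayer spectrum is the non-bonding family together with the even
(bonding ⊕ antibonding) family, with multiplicity.  This is the three-plane version of the even/odd
plane-band construction of [AndersenEtAl1995, §8 Eq. (23)].  No commutation hypothesis on
`H, K, T, S` is needed.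

## 2. The scalar (per-`k`) trilayer

For real numbers (outer energy `εo`, inner energy `εi`, outer–inner hopping `t`, outer–outer
hopping `s`) the `3 × 3` matrix `!![εo, s, t; s, εo, t; t, t, εi]` has the non-bonding eigenvector
`(1, −1, 0)` with eigenvalue `εo − s` for EVERY `εi, t` (`trilayerScalar_mulVec_nonbonding`): the
inner plane carries exactly zero weight in that band (`trilayerScalar_nonbonding_innerWeight`).
When the even outer level is degenerate with the inner one (`εi = εo + s`; e.g. three identical
planes with `s = 0`) the other two eigenvectors are `(1, 1, ±√2)` with eigenvalues `εi ± √2·t`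
(`trilayerScalar_mulVec_even_of_degenerate`) and inner-plane weight exactly `1/2` each
(`trilayerScalar_even_innerWeight_of_degenerate`) — the `2t cos(jπ/4)`, `j = 1, 2, 3`, levels of
three identical coupled planes.  Off degeneracy the even pair is the `2 × 2` problem of Section 1
(`trilayerScalar_mulVec_even`); nothing further is asserted about that general case.

Not here: anything approximate (sizes of `t⊥`, the `< 5 %` inner admixture of real band
structures, `k_z` dispersion), four or more layers, inequivalent outer planes.

References: H. Sakakibara, M. Ochi, H. Nagata, Y. Ueki, H. Sakurai, R. Matsumoto, K. Terashima,
K. Hirose, H. Ohta, M. Kato, Y. Takano, K. Kuroki, *Theoretical analysis on the possibility of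
superconductivity in the trilayer Ruddlesden-Popper nickelate La₄Ni₃O₁₀ under pressure and its
experimental examination: Comparison with La₃Ni₂O₇*, Phys. Rev. B 109 (2024) 144511,
arXiv:2309.09462, §III, Fig. 2, Table I · O. K. Andersen, A. I. Liechtenstein, O. Jepsen,
F. Paulsen, *LDA energy bands, low-energy Hamiltonians, t′, t″, t⊥(k), and J⊥*, J. Phys. Chem.
Solids 56 (1995) 1573, arXiv:cond-mat/9509044, §8.
AI-produced formalisation (H21, cell hubbard-downfold, seat lit-2, 2026-08-27); no facts, no axioms
beyond Mathlib's, no `sorry`.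
-/

namespace Literature.MathematicalPhysics.QuantumLattice

open Matrix

/-! ## 1. Block form: odd (non-bonding) decoupling and the even ⊕ inner block -/

section Block

variable {n : Type*} {R : Type*}

/-- The mirror-symmetric TRILAYER one-particle matrix in the layer order (outer₁ | outer₂, inner):
outer planes `H`, inner plane `K`, outer–inner coupling `T` (both outer planes), direct outer–outer
coupling `S`.  As a `3 × 3` block array it reads `[[H, S, T], [S, H, T], [T, T, K]]`.
[cite: SakakibaraEtAl2024, §III Fig. 2 and Table I] -/
def trilayer (H K T S : Matrix n n R) : Matrix (n ⊕ (n ⊕ n)) (n ⊕ (n ⊕ n)) R :=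
  fromBlocks H (fromCols S T) (fromRows S T) (fromBlocks H T T K)

/-- Unfolding of `trilayer`. [cite: SakakibaraEtAl2024, §III Fig. 2 and Table I] -/
theorem trilayer_def (H K T S : Matrix n n R) :
    trilayer H K T S = fromBlocks H (fromCols S T) (fromRows S T) (fromBlocks H T T K) := rfl

variable [CommRing R]

/-- Two row-partitioned matrices add blockwise. [cite: AndersenEtAl1995, §8 Eq. (23)] -/
private theorem fromRows_add' {m₁ m₂ : Type*} (A₁ B₁ : Matrix m₁ n R) (A₂ B₂ : Matrix m₂ n R) :
    fromRows A₁ A₂ + fromRows B₁ B₂ = fromRows (A₁ + B₁) (A₂ + B₂) := by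
  ext (i | i) j <;> rfl

/-- Two column-partitioned matrices add blockwise. [cite: AndersenEtAl1995, §8 Eq. (23)] -/
private theorem fromCols_add' {n₁ n₂ : Type*} (A₁ B₁ : Matrix n n₁ R) (A₂ B₂ : Matrix n n₂ R) :
    fromCols A₁ A₂ + fromCols B₁ B₂ = fromCols (A₁ + B₁) (A₂ + B₂) := by
  ext i (j | j) <;> rfl

/-- Scalar multiples of a column-partitioned matrix. [cite: AndersenEtAl1995, §8 Eq. (23)] -/
private theorem smul_fromCols' {n₁ n₂ : Type*} (c : R) (A₁ : Matrix n n₁ R) (A₂ : Matrix n n₂ R) :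
    c • fromCols A₁ A₂ = fromCols (c • A₁) (c • A₂) := by
  ext i (j | j) <;> rfl

/-- Scalar multiples of a row-partitioned matrix. [cite: AndersenEtAl1995, §8 Eq. (23)] -/
private theorem smul_fromRows' {m₁ m₂ : Type*} (c : R) (A₁ : Matrix m₁ n R) (A₂ : Matrix m₂ n R) :
    c • fromRows A₁ A₂ = fromRows (c • A₁) (c • A₂) := by
  ext (i | i) j <;> rfl

/-- **The non-bonding band is exactly outer-plane odd** [cite: SakakibaraEtAl2024, §III and Fig. 2
caption]: if `(H − S) x = ω x` then `(x, −x, 0)` — odd in the two outer planes, ZERO on the inner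
plane — is an eigenvector of the trilayer with eigenvalue `ω`, whatever the inner block `K` and the
outer–inner coupling `T` are. -/
theorem trilayer_mulVec_odd [Fintype n] (H K T S : Matrix n n R) (x : n → R) (ω : R)
    (hx : (H - S) *ᵥ x = ω • x) :
    trilayer H K T S *ᵥ Sum.elim x (Sum.elim (-x) 0) = ω • Sum.elim x (Sum.elim (-x) 0) := by
  rw [Matrix.sub_mulVec] at hx
  rw [trilayer, fromBlocks_mulVec, Sum.elim_comp_inl, Sum.elim_comp_inr, fromCols_mulVec_sumElim,
    fromRows_mulVec, fromBlocks_mulVec, Sum.elim_comp_inl, Sum.elim_comp_inr]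
  simp only [Matrix.mulVec_neg, Matrix.mulVec_zero, add_zero]
  funext i
  rcases i with j | i
  · have h := congrFun hx j
    simp only [Pi.sub_apply, Pi.smul_apply] at h
    simp only [Sum.elim_inl, Pi.add_apply, Pi.neg_apply, Pi.smul_apply]
    rw [← h]
    ring
  · rcases i with j | j
    · have h := congrFun hx j
      simp only [Pi.sub_apply, Pi.smul_apply, smul_eq_mul] at h
      simp only [Sum.elim_inr, Sum.elim_inl, Pi.add_apply, Pi.neg_apply, Pi.smul_apply,
        smul_eq_mul]
      rw [mul_neg, ← h]
      ring
    · simp only [Sum.elim_inr, Pi.add_apply, Pi.neg_apply, Pi.smul_apply, Pi.zero_apply,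
        smul_eq_mul, mul_zero, add_neg_cancel]

/-- **The even sector is a two-block problem** [cite: SakakibaraEtAl2024, §III and Fig. 2 caption]:
if `(y, z)` is an eigenvector of `fromBlocks (H + S) T (2 • T) K` (outer-even block `H + S`, inner
block `K`, couplings `T` and `2 • T` — the factor `2` counts the two outer planes feeding the inner
one), then `(y, y, z)` is an eigenvector of the trilayer with the same eigenvalue (the bonding and
antibonding bands). -/
theorem trilayer_mulVec_even [Fintype n] (H K T S : Matrix n n R) (y z : n → R) (ω : R)
    (hyz : fromBlocks (H + S) T ((2 : R) • T) K *ᵥ Sum.elim y z = ω • Sum.elim y z) :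
    trilayer H K T S *ᵥ Sum.elim y (Sum.elim y z) = ω • Sum.elim y (Sum.elim y z) := by
  rw [fromBlocks_mulVec, Sum.elim_comp_inl, Sum.elim_comp_inr, Matrix.add_mulVec,
    Matrix.smul_mulVec] at hyz
  have h1 : H *ᵥ y + S *ᵥ y + T *ᵥ z = ω • y := by
    funext j; simpa only [Sum.elim_inl, Pi.add_apply, Pi.smul_apply] using congrFun hyz (Sum.inl j)
  have h2 : (2 : R) • (T *ᵥ y) + K *ᵥ z = ω • z := by
    funext j; simpa only [Sum.elim_inr, Pi.add_apply, Pi.smul_apply] using congrFun hyz (Sum.inr j)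
  rw [trilayer, fromBlocks_mulVec, Sum.elim_comp_inl, Sum.elim_comp_inr, fromCols_mulVec_sumElim,
    fromRows_mulVec, fromBlocks_mulVec, Sum.elim_comp_inl, Sum.elim_comp_inr]
  funext i
  rcases i with j | i
  · have h := congrFun h1 j
    simp only [Pi.add_apply, Pi.smul_apply] at h
    simp only [Sum.elim_inl, Pi.add_apply, Pi.smul_apply]
    rw [← h]
    ring
  · rcases i with j | j
    · have h := congrFun h1 j
      simp only [Pi.add_apply, Pi.smul_apply] at h
      simp only [Sum.elim_inr, Sum.elim_inl, Pi.add_apply, Pi.smul_apply]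
      rw [← h]
      ring
    · have h := congrFun h2 j
      simp only [Pi.add_apply, Pi.smul_apply, smul_eq_mul] at h
      simp only [Sum.elim_inr, Pi.add_apply, Pi.smul_apply, smul_eq_mul]
      rw [← h]
      ring

/-- The block-DIAGONAL partner of the trilayer: the odd (non-bonding) block `H − S` and the
even ⊕ inner block `fromBlocks (H + S) (2 • T) T K`. [cite: SakakibaraEtAl2024, §III Fig. 2] -/
def trilayerSplit (H K T S : Matrix n n R) : Matrix (n ⊕ (n ⊕ n)) (n ⊕ (n ⊕ n)) R :=
  fromBlocks (H - S) 0 0 (fromBlocks (H + S) ((2 : R) • T) T K)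

/-- Unfolding of `trilayerSplit`. [cite: SakakibaraEtAl2024, §III Fig. 2] -/
theorem trilayerSplit_def (H K T S : Matrix n n R) :
    trilayerSplit H K T S = fromBlocks (H - S) 0 0 (fromBlocks (H + S) ((2 : R) • T) T K) := rfl

variable [DecidableEq n]

/-- The unnormalised odd/even combiner of the two OUTER planes, identity on the inner plane:
`P (x₁ | x₂, x₃) = (x₁ − x₂ | x₁ + x₂, x₃)`. [cite: AndersenEtAl1995, §8 Eq. (23)] -/
def trilayerCombiner : Matrix (n ⊕ (n ⊕ n)) (n ⊕ (n ⊕ n)) R :=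
  fromBlocks 1 (fromCols (-1) 0) (fromRows 1 0) 1

/-- Unfolding of the combiner. [cite: AndersenEtAl1995, §8 Eq. (23)] -/
theorem trilayerCombiner_def :
    (trilayerCombiner : Matrix (n ⊕ (n ⊕ n)) (n ⊕ (n ⊕ n)) R)
      = fromBlocks 1 (fromCols (-1) 0) (fromRows 1 0) 1 := rfl

/-- The action of the combiner on a layer vector: `(x₁ | x₂, x₃) ↦ (x₁ − x₂ | x₁ + x₂, x₃)`.
[cite: AndersenEtAl1995, §8 Eq. (23)] -/
theorem trilayerCombiner_mulVec [Fintype n] (x₁ x₂ x₃ : n → R) :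
    (trilayerCombiner : Matrix (n ⊕ (n ⊕ n)) (n ⊕ (n ⊕ n)) R) *ᵥ Sum.elim x₁ (Sum.elim x₂ x₃)
      = Sum.elim (x₁ - x₂) (Sum.elim (x₁ + x₂) x₃) := by
  rw [trilayerCombiner, ← fromBlocks_one, fromBlocks_mulVec, Sum.elim_comp_inl, Sum.elim_comp_inr,
    fromCols_mulVec_sumElim, fromRows_mulVec, fromBlocks_mulVec, Sum.elim_comp_inl,
    Sum.elim_comp_inr]
  simp only [Matrix.one_mulVec, Matrix.neg_mulVec, Matrix.zero_mulVec, add_zero, zero_add]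
  funext i
  rcases i with j | i
  · simp only [Sum.elim_inl, Pi.add_apply, Pi.neg_apply, Pi.sub_apply]
    ring
  · rcases i with j | j
    · simp only [Sum.elim_inr, Sum.elim_inl, Pi.add_apply]
    · simp only [Sum.elim_inr, Pi.add_apply, Pi.zero_apply, zero_add]

/-- **Intertwining identity** [cite: AndersenEtAl1995, §8 Eq. (23)]: over ANY commutative ring,
`P * trilayer H K T S = trilayerSplit H K T S * P` — in the (odd | even, inner) coordinates the
trilayer is block-diagonal with blocks `H − S` and `fromBlocks (H + S) (2 • T) T K`.  No hypothesis
relating `H, K, T, S`. -/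
theorem trilayerCombiner_mul_trilayer [Fintype n] (H K T S : Matrix n n R) :
    trilayerCombiner * trilayer H K T S = trilayerSplit H K T S * trilayerCombiner := by
  rw [trilayerCombiner, trilayer, trilayerSplit, fromBlocks_multiply, fromBlocks_multiply,
    fromRows_mul_fromCols]
  simp only [Matrix.one_mul, Matrix.mul_one, Matrix.zero_mul, Matrix.mul_zero, add_zero, zero_add,
    fromCols_mul_fromRows, fromCols_mul_fromBlocks, fromRows_mul, mul_fromCols,
    fromBlocks_mul_fromRows, Matrix.neg_mul, Matrix.one_mul, Matrix.zero_mul, Matrix.mul_neg,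
    Matrix.mul_one, Matrix.mul_zero, add_zero, fromCols_add', fromRows_add', fromBlocks_add,
    two_smul]
  congr 1 <;> abel

variable [Invertible (2 : R)]

/-- The inverse combiner (when `2` is invertible):
`(o | e, z) ↦ (½(o + e) | ½(e − o), z)`. [cite: AndersenEtAl1995, §8 Eq. (23)] -/
def trilayerCombinerInv : Matrix (n ⊕ (n ⊕ n)) (n ⊕ (n ⊕ n)) R :=
  fromBlocks ((⅟ (2 : R)) • 1) (fromCols ((⅟ (2 : R)) • 1) 0)
    (fromRows (-((⅟ (2 : R)) • 1)) 0) (fromBlocks ((⅟ (2 : R)) • 1) 0 0 1)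

/-- Unfolding of the inverse combiner. [cite: AndersenEtAl1995, §8 Eq. (23)] -/
theorem trilayerCombinerInv_def :
    (trilayerCombinerInv : Matrix (n ⊕ (n ⊕ n)) (n ⊕ (n ⊕ n)) R)
      = fromBlocks ((⅟ (2 : R)) • 1) (fromCols ((⅟ (2 : R)) • 1) 0)
          (fromRows (-((⅟ (2 : R)) • 1)) 0) (fromBlocks ((⅟ (2 : R)) • 1) 0 0 1) := rfl

/-- `⅟2 + ⅟2 = 1` inside the matrix ring. [cite: AndersenEtAl1995, §8 Eq. (23)] -/
private theorem invOf_two_smul_one_add :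
    (⅟ (2 : R)) • (1 : Matrix n n R) + (⅟ (2 : R)) • 1 = 1 := by
  rw [← add_smul, invOf_two_add_invOf_two, one_smul]

/-- `P * P⁻¹ = 1`. [cite: AndersenEtAl1995, §8 Eq. (23)] -/
theorem trilayerCombiner_mul_inv [Fintype n] :
    (trilayerCombiner : Matrix (n ⊕ (n ⊕ n)) (n ⊕ (n ⊕ n)) R) * trilayerCombinerInv = 1 := by
  rw [trilayerCombiner, trilayerCombinerInv, fromBlocks_multiply, fromRows_mul_fromCols]
  simp only [Matrix.one_mul, Matrix.mul_one, fromCols_mul_fromRows, fromCols_mul_fromBlocks,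
    Matrix.neg_mul, Matrix.one_mul, Matrix.mul_zero, Matrix.mul_smul, Matrix.mul_one, neg_neg,
    smul_neg, add_zero, zero_add, fromCols_add', fromRows_add', fromBlocks_add, smul_fromRows',
    smul_zero, add_neg_cancel, fromCols_zero, fromRows_zero, invOf_two_smul_one_add,
    fromBlocks_one]

/-- `P⁻¹ * P = 1`. [cite: AndersenEtAl1995, §8 Eq. (23)] -/
theorem trilayerCombinerInv_mul [Fintype n] :
    (trilayerCombinerInv : Matrix (n ⊕ (n ⊕ n)) (n ⊕ (n ⊕ n)) R) * trilayerCombiner = 1 := by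
  rw [trilayerCombiner, trilayerCombinerInv, fromBlocks_multiply, fromRows_mul_fromCols]
  simp only [Matrix.one_mul, Matrix.mul_one, fromCols_mul_fromRows, fromBlocks_mul_fromRows,
    Matrix.one_mul, Matrix.mul_zero, Matrix.smul_mul, Matrix.mul_one, Matrix.mul_neg, neg_neg,
    neg_zero, smul_neg, add_zero, zero_add, fromCols_add', fromRows_add', fromBlocks_add,
    smul_fromCols', smul_zero, neg_add_cancel, fromCols_zero, fromRows_zero,
    invOf_two_smul_one_add, fromBlocks_one]

/-- Similarity form (when `2` is invertible): `P * trilayer * P⁻¹ = trilayerSplit`.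
[cite: AndersenEtAl1995, §8 Eq. (23)] -/
theorem trilayerCombiner_conj_trilayer [Fintype n] (H K T S : Matrix n n R) :
    trilayerCombiner * trilayer H K T S * trilayerCombinerInv = trilayerSplit H K T S := by
  rw [trilayerCombiner_mul_trilayer, Matrix.mul_assoc, trilayerCombiner_mul_inv, Matrix.mul_one]

/-- **Non-bonding ⊕ (bonding, antibonding) spectrum** [cite: SakakibaraEtAl2024, §III and Fig. 2
caption]: for a mirror-symmetric trilayer the characteristic polynomial factorises into that of the
odd (non-bonding, purely outer-plane) block `H − S` and that of the even ⊕ inner block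
`fromBlocks (H + S) (2 • T) T K` (over any commutative ring in which `2` is invertible; over `ℝ`/`ℂ`
the trilayer eigenvalues with multiplicity are exactly the union of the two families).  The
three-plane analogue of `charpoly_bilayer` [AndersenEtAl1995, §8 Eq. (23)]. -/
theorem charpoly_trilayer [Fintype n] (H K T S : Matrix n n R) :
    (trilayer H K T S).charpoly
      = (H - S).charpoly * (fromBlocks (H + S) ((2 : R) • T) T K).charpoly := by
  have hQP : (trilayerCombinerInv : Matrix (n ⊕ (n ⊕ n)) (n ⊕ (n ⊕ n)) R) * trilayerCombiner = 1 :=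
    trilayerCombinerInv_mul
  calc (trilayer H K T S).charpoly
      = (trilayer H K T S * (trilayerCombinerInv * trilayerCombiner)).charpoly := by
          rw [hQP, Matrix.mul_one]
    _ = ((trilayer H K T S * trilayerCombinerInv) * trilayerCombiner).charpoly := by
          rw [Matrix.mul_assoc]
    _ = (trilayerCombiner * (trilayer H K T S * trilayerCombinerInv)).charpoly :=
          Matrix.charpoly_mul_comm _ _
    _ = (trilayerSplit H K T S).charpoly := by
          rw [← Matrix.mul_assoc, trilayerCombiner_conj_trilayer]
    _ = (H - S).charpoly * (fromBlocks (H + S) ((2 : R) • T) T K).charpoly :=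
          Matrix.charpoly_fromBlocks_zero₁₂ (H - S) 0 _

end Block

/-! ## 2. The scalar (per-`k`) trilayer over `ℝ` -/

section Scalar

/-- The scalar trilayer at one momentum: outer on-site/dispersion `εo`, inner `εi`, outer–inner
hopping `t`, direct outer–outer hopping `s`; layer order (outer₁, outer₂, inner).
[cite: SakakibaraEtAl2024, §III Fig. 2 and Table I] -/
def trilayerScalar (εo εi t s : ℝ) : Matrix (Fin 3) (Fin 3) ℝ :=
  !![εo, s, t; s, εo, t; t, t, εi]

/-- Unfolding. [cite: SakakibaraEtAl2024, §III Fig. 2 and Table I] -/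
theorem trilayerScalar_def (εo εi t s : ℝ) :
    trilayerScalar εo εi t s = !![εo, s, t; s, εo, t; t, t, εi] := rfl

/-- **Non-bonding band** [cite: SakakibaraEtAl2024, §III and Fig. 2 caption]: `(1, −1, 0)` is an
eigenvector with eigenvalue `εo − s`, for every inner energy `εi` and every outer–inner hopping `t`. -/
theorem trilayerScalar_mulVec_nonbonding (εo εi t s : ℝ) :
    trilayerScalar εo εi t s *ᵥ ![1, -1, 0] = (εo - s) • ![1, -1, 0] := by
  ext i
  fin_cases i <;> simp [trilayerScalar, Matrix.mulVec, dotProduct, Fin.sum_univ_three] <;> ring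

/-- The squared inner-plane amplitude of the non-bonding eigenvector, divided by its squared norm,
is exactly `0`: the inner plane is invisible to the non-bonding band.
[cite: SakakibaraEtAl2024, Fig. 2 caption] -/
theorem trilayerScalar_nonbonding_innerWeight :
    ((![1, -1, 0] : Fin 3 → ℝ) 2) ^ 2
        / (((![1, -1, 0] : Fin 3 → ℝ) 0) ^ 2 + ((![1, -1, 0] : Fin 3 → ℝ) 1) ^ 2
            + ((![1, -1, 0] : Fin 3 → ℝ) 2) ^ 2) = 0 := by
  simp

/-- The even sector at one momentum: for an outer-even vector `(a, a, b)` the trilayer acts as the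
`2 × 2` block `[[εo + s, t], [2t, εi]]` on `(a, b)` — the scalar case of `trilayer_mulVec_even`.
[cite: SakakibaraEtAl2024, §III and Fig. 2 caption] -/
theorem trilayerScalar_mulVec_even (εo εi t s a b : ℝ) :
    trilayerScalar εo εi t s *ᵥ ![a, a, b]
      = ![(εo + s) * a + t * b, (εo + s) * a + t * b, 2 * t * a + εi * b] := by
  ext i
  fin_cases i <;> simp [trilayerScalar, Matrix.mulVec, dotProduct, Fin.sum_univ_three] <;> ring

/-- **Degenerate even sector** [cite: SakakibaraEtAl2024, §III]: when the outer-even level equals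
the inner level (`εi = εo + s`; e.g. three identical planes with `s = 0`), the bonding/antibonding
eigenvectors are `(1, 1, σ√2)` with eigenvalues `εi + σ√2·t`, for `σ` with `σ² = 1` — the
`2t cos(jπ/4)` levels of three coupled identical planes. -/
theorem trilayerScalar_mulVec_even_of_degenerate (εo εi t s σ : ℝ) (hdeg : εi = εo + s)
    (hσ : σ ^ 2 = 1) :
    trilayerScalar εo εi t s *ᵥ ![1, 1, σ * Real.sqrt 2]
      = (εi + σ * Real.sqrt 2 * t) • ![1, 1, σ * Real.sqrt 2] := by
  have h2 : Real.sqrt 2 * Real.sqrt 2 = 2 := Real.mul_self_sqrt (by norm_num)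
  have key : σ * Real.sqrt 2 * (σ * Real.sqrt 2) = 2 := by
    calc σ * Real.sqrt 2 * (σ * Real.sqrt 2) = σ ^ 2 * (Real.sqrt 2 * Real.sqrt 2) := by ring
      _ = 2 := by rw [hσ, h2, one_mul]
  ext i
  fin_cases i
  · simp [trilayerScalar, Matrix.mulVec, dotProduct, Fin.sum_univ_three, hdeg]
    ring
  · simp [trilayerScalar, Matrix.mulVec, dotProduct, Fin.sum_univ_three, hdeg]
    ring
  · simp [trilayerScalar, Matrix.mulVec, dotProduct, Fin.sum_univ_three, hdeg]
    linear_combination (-t) * key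

/-- In the degenerate case the bonding and antibonding eigenvectors `(1, 1, ±√2)` each carry
inner-plane weight exactly `1/2` (squared inner amplitude over squared norm `2/(1 + 1 + 2)`);
together with the non-bonding `0` the three inner weights sum to `1`.
[cite: SakakibaraEtAl2024, Fig. 2 caption] -/
theorem trilayerScalar_even_innerWeight_of_degenerate (σ : ℝ) (hσ : σ ^ 2 = 1) :
    (σ * Real.sqrt 2) ^ 2 / (1 ^ 2 + 1 ^ 2 + (σ * Real.sqrt 2) ^ 2) = 1 / 2 := by
  have h2 : Real.sqrt 2 ^ 2 = 2 := Real.sq_sqrt (by norm_num)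
  rw [mul_pow, hσ, h2]
  norm_num

end Scalar

end Literature.MathematicalPhysics.QuantumLattice
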